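import Summits.BirchSwinnertonDyer.BirchSwinnertonDyer.Theorems.OneSidedTwistSqueezeX9KatoDivisibilityX9ResidualWidth
import HarnessLib

set_option autoImplicit false

-- the summit and its single problem are both named `BirchSwinnertonDyer` (registry layout D-0017)
set_option linter.dupNamespace false

/-!
# WIDTH in tree currency, II: B2 (`SIM.FineMuConcentratedOnClassX9`) at an X9 pair is EXACTLY «`w(X₀) = μ(X₀/pX₀) ≤ 1`»,
# Conjecture A at a pair is «`w(X₀) = 0`»; DEPTH ⟹ `μ(X₀) ≤ n·w(X₀)`; DEPTH ∧ «`w ≤ 1` on X9» ⟹ S-es-3 (⟹ the crux)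

Seat `bsd-line-k6-p4` (prover-bsd-line-k6-p4-g4-0, 4th LEAD on crux stmt-BirchSwinnertonDyer-20547 `KatoDivisibilityX9`,
route `OneSidedTwistSqueezeX9`, host cell `bsd-f3-mu`).  THEOREMS ONLY, sorry-free, no definition, no named fact,
nothing asserted about any curve.  `--supports stmt-BirchSwinnertonDyer-20547`.  Sibling of `…ResidualWidth.lean` (the
graded bound `μ(M) ≤ μ(p^nM) + n·w(M)` and the width certificate `w(M) ≤ 1 ⟹ [μ(p^nM) = 0 → μ(M) ≤ n]`, `w(M) := μ(M/pM)`).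

* §2′ (`Λ`, `M` finitely generated torsion): `exists_lengthAt_pow_smul_top_eq_zero` (some `p^vM` has `ℓ_(p) = 0`: the
  annihilator contains `p^v·t`, `p ∤ t`); the CONVERSES `residualWidth_le_one_of_forall_mu_le` — **`[∀ n, μ(p^nM) = 0 →
  μ(M) ≤ n] ⟹ w(M) ≤ 1`** — and `muInvariant_eq_zero_iff_residualWidth_eq_zero` — **`μ(M) = 0 ⟺ w(M) = 0`** (Nakayama at
  `(p)` by length counting along the graded pieces; no structure theory); `forall_mu_le_iff_residualWidth_le_one`.
* §3 (pairs and the class): `fineMuConcentratedOnClassX9_of_residualWidth_le_one` — «`w(X₀) ≤ 1` at every X9 pair» ⟹ B2,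
  UNCONDITIONALLY (no F1_ζ, no modularity); `residualWidth_le_one_of_fineMuConcentratedOnClassX9` — the converse modulo
  the finite/torsion guards (F1_ζ + a modularity witness, as in p612403); `fineMuZero_iff_residualWidth_eq_zero` — at an
  odd good ordinary pair, `μ(X₀) = 0 ⟺ w(X₀) = 0` under the same guards.  So ON X9: **Conjecture A ⟺ `w(X₀) = 0` and
  B2 ⟺ `w(X₀) ≤ 1` — the SAME invariant, threshold `1` instead of `0`.**
* §4 (line currency): `fineMu_le_mul_residualWidth_of_depth` — DEPTH (ES-C4) gives `μ(X₀) ≤ n·w(X₀)` whenever a genuine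
  Euler-system class has loss `≤ n` (MEMO-es §14 (N2) `μ(X₀) ≤ s_μ·δ` in the kernel, `s_μ = w`);
  `fineMuLeEulerLossOnClassX9_of_depth_of_residualWidth_le_one` — DEPTH ∧ «`w ≤ 1` on X9» ⟹ S-es-3
  (`SIM.FineMuLeEulerLossOnClassX9`), whence the ROUTE decl by the landed Theses-side edge
  `katoDivisibilityX9_of_fineMuLeEulerLossOnClassX9` (p610638; not imported — this file stays Theses-free).

HONEST LABEL.  Nothing here decides B2: it is RE-EXPRESSED, exactly, as «`w(X₀(E/ℚ_∞)) ≤ 1` at every X9 pair», one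
storey above Conjecture A (`w = 0`) in the same currency; `w(X₀)` is the `Ω`-corank of `Sel₀(ℚ_∞, E[p^∞])[p]` (graded
Pontryagin duality, `KatoFineSelmerDualGraded`), the typed target for a WidthX9 crux-ideate chain (host TURNKEY-5).  B2,
ES-C4 (`n ≥ 1`), Conj A on X9 stay OPEN; PARTITION untouched; beyond-print theorem toward BSD: NO; BSD is not proved by
any of this.

References: L. Washington, GTM 83, §13.2 [Washington1997]; J. Coates, R. Sujatha, Math. Ann. 331 (2005) §3 Conj. A
[CoatesSujatha2005]; K. Kato, Astérisque 295 (2004) Thm. 12.4 (1), Thm. 13.4, §13.8, §17.13 [Kato2004Asterisque];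
HOME/MEMO-es.md §14, §22, §25.6.
-/
noncomputable section

open scoped Classical MatrixGroups ModularForm NumberField
open CongruenceSubgroup WeierstrassCurve Field
open Literature.NumberTheory.GaloisRepresentations
open Literature.NumberTheory.EllipticCurves Literature.NumberTheory.EllipticCurves.ModularForms
open Literature.NumberTheory.EllipticCurves.Kato2004
open Literature.NumberTheory.EllipticCurves.Kato2004.EulerSystemValues
open Summit.BirchSwinnertonDyer.BirchSwinnertonDyer.Rank1Residual (ClassX9)
open Summit.BirchSwinnertonDyer.Rank1Residual.SmallImageMu (FineMuLeEulerLossOnClassX9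
  FineExponentLeEulerLossOnClassX9 FineMuConcentratedOnClassX9 fineMuLeEulerLossOnClassX9_of_exponent_of_concentrated)
open Summit.BirchSwinnertonDyer.BirchSwinnertonDyer.Theorems.OneSidedTwistSqueezeX9KatoDivisibilityX9OfGradedEulerLossLattice
  (finite_and_isTorsion_fine_of_zeta)
open Module IwasawaAlgebra

open Summit.BirchSwinnertonDyer.BirchSwinnertonDyer.Theorems.OneSidedTwistSqueezeX9KatoDivisibilityX9ResidualWidth

namespace Summit.BirchSwinnertonDyer.BirchSwinnertonDyer.Theorems.OneSidedTwistSqueezeX9KatoDivisibilityX9ResidualWidthX9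

/-! ## §2′ Over `Λ`, `M` finitely generated torsion: finite `p`-exponent, the converses -/

section Lambda

variable {p : ℕ} [Fact p.Prime] {M : Type*} [AddCommGroup M] [_root_.Module (IwasawaAlgebra p) M]

/-- **Finite `p`-exponent at `(p)`**: a finitely generated torsion `Λ`-module has `ℓ_(p)(p^v M) = 0` for some `v` —
its annihilator contains a non-zero `s = p^v·t` with `p ∤ t`, and `t ∉ (p)` kills `p^vM`. [cite: Washington1997, §13.2] -/
theorem exists_lengthAt_pow_smul_top_eq_zero [Module.Finite (IwasawaAlgebra p) M]
    (hM : Module.IsTorsion (IwasawaAlgebra p) M) :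
    ∃ v : ℕ, lengthAt (IwasawaAlgebra p) ↥((augIdealP p ^ v) • (⊤ : Submodule (IwasawaAlgebra p) M))
      ⟨augIdealP p, isPrime_augIdealP_holds p⟩ = 0 := by
  obtain ⟨s, hs, hs0⟩ := Submodule.annihilator_top_inter_nonZeroDivisors hM
  have hsne : s ≠ 0 := nonZeroDivisors.ne_zero hs0
  have hp : (p : ℤ_[p]) ≠ 0 := Nat.cast_ne_zero.mpr (Fact.out : p.Prime).ne_zero
  have hC0 : (PowerSeries.C (p : ℤ_[p]) : IwasawaAlgebra p) ≠ 0 := by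
    intro h
    exact hp (PowerSeries.C_injective (by simpa using h))
  have hprime : Prime (PowerSeries.C (p : ℤ_[p]) : IwasawaAlgebra p) :=
    (Ideal.span_singleton_prime hC0).mp (isPrime_augIdealP_holds p)
  have hfin : FiniteMultiplicity (PowerSeries.C (p : ℤ_[p]) : IwasawaAlgebra p) s :=
    FiniteMultiplicity.of_prime_left hprime hsne
  obtain ⟨t, hst, ht⟩ := hfin.exists_eq_pow_mul_and_not_dvd
  set v := multiplicity (PowerSeries.C (p : ℤ_[p]) : IwasawaAlgebra p) s with hv
  refine ⟨v, lengthAt_eq_zero_of_isTorsionBy (s := t) ?_ _ ?_⟩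
  · rintro ⟨m, hm⟩
    rw [augIdealP, Ideal.span_singleton_pow, Submodule.ideal_span_singleton_smul] at hm
    obtain ⟨m', -, rfl⟩ := (Submodule.mem_smul_pointwise_iff_exists m _ _).mp hm
    refine Subtype.ext ?_
    change t • (PowerSeries.C (p : ℤ_[p]) : IwasawaAlgebra p) ^ v • m' = 0
    rw [← mul_smul, mul_comm, ← hst]
    exact Submodule.mem_annihilator.mp hs m' Submodule.mem_top
  · change t ∉ augIdealP p
    rw [augIdealP, Ideal.mem_span_singleton]
    exact ht

/-- A bookkeeping lemma on sequences of naturals: if `b j = b (j+1) + a j`, `a` is antitone, `b v = 0` for some `v`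
and `2 ≤ a 0`, then some `d` has `b d = 0` and `d + 1 ≤ b 0`. [folklore] -/
theorem exists_eq_zero_and_succ_le (a b : ℕ → ℕ) (hb : ∀ j, b j = b (j + 1) + a j)
    (ha : ∀ j, a (j + 1) ≤ a j) {v : ℕ} (hv : b v = 0) (h2 : 2 ≤ a 0) :
    ∃ d, b d = 0 ∧ d + 1 ≤ b 0 := by
  classical
  -- `b` and `a` are antitone
  have hbmono : ∀ i k, b (i + k) ≤ b i := by
    intro i k
    induction k with
    | zero => simp
    | succ k ih =>
      have h1 := hb (i + k)
      rw [← add_assoc]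
      omega
  have hamono : ∀ i k, a (i + k) ≤ a i := by
    intro i k
    induction k with
    | zero => simp
    | succ k ih =>
      have h1 := ha (i + k)
      rw [← add_assoc]
      exact h1.trans ih
  -- the least zero `d` of `b`
  have hex : ∃ d, b d = 0 := ⟨v, hv⟩
  let d := Nat.find hex
  have hd : b d = 0 := Nat.find_spec hex
  have hmin : ∀ j, j < d → b j ≠ 0 := fun j hj => Nat.find_min hex hj
  -- `a j ≥ 1` for `j < d`
  have hapos : ∀ j, j < d → 1 ≤ a j := by
    intro j hj
    by_contra h0
    push Not at h0
    have ha0 : ∀ k, a (j + k) = 0 := fun k => by have := hamono j k; omega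
    -- then `b` is constant from `j` on
    have hconst : ∀ k, b (j + k) = b j := by
      intro k
      induction k with
      | zero => simp
      | succ k ih =>
        have h1 := hb (j + k)
        have h3 := ha0 k
        rw [← add_assoc]
        omega
    have hbj : b j = 0 := by
      rcases le_or_gt j v with hjv | hvj
      · obtain ⟨k, hk⟩ := Nat.exists_eq_add_of_le hjv
        rw [← hconst k, ← hk]
        exact hv
      · obtain ⟨k, hk⟩ := Nat.exists_eq_add_of_lt hvj
        have h1 := hbmono v (k + 1)
        rw [show v + (k + 1) = j by omega] at h1
        omega
    exact hmin j hj hbj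
  -- `b 0 = b j + Σ_{i<j} a i`, and the sum over `i < d` is `≥ a 0 + (d - 1)`
  have hsum : ∀ j, b 0 = b j + ∑ i ∈ Finset.range j, a i := by
    intro j
    induction j with
    | zero => simp
    | succ j ih => rw [Finset.sum_range_succ, ih, hb j]; ring
  have hd0 : d ≠ 0 := by
    intro h
    have hb00 : b 0 = 0 := by
      have hd' := hd
      rwa [h] at hd'
    have h01 := hb 0
    omega
  refine ⟨d, hd, ?_⟩
  rw [hsum d, hd, zero_add]
  obtain ⟨d', hd'⟩ : ∃ d', d = d' + 1 := ⟨d - 1, by omega⟩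
  rw [hd', Finset.sum_range_succ']
  have h1 : d' ≤ ∑ i ∈ Finset.range d', a (i + 1) := by
    calc d' = ∑ _i ∈ Finset.range d', 1 := by simp
      _ ≤ ∑ i ∈ Finset.range d', a (i + 1) :=
        Finset.sum_le_sum fun i hi => hapos (i + 1) (by rw [hd']; simp only [Finset.mem_range] at hi; omega)
  omega

/-- **CONVERSE of the width certificate: B2's module statement forces `μ(M/pM) ≤ 1`** for `M` finitely generated
torsion: if `w := μ(M/pM) ≥ 2`, let `d` be least with `μ(p^dM) = 0` (exists by `exists_lengthAt_pow_smul_top_eq_zero`);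
every graded piece `p^jM/p^{j+1}M`, `j < d`, has positive length (else `μ(p^jM) = μ(p^dM) = 0`), the pieces shrink, and the
first has length `w ≥ 2`, so `μ(M) = Σ_{j<d} ℓ(p^jM/p^{j+1}M) ≥ d + 1 > d`, contradicting `μ(p^dM) = 0 → μ(M) ≤ d`.
No structure theory. [cite: Washington1997, §13.2] -/
theorem residualWidth_le_one_of_forall_mu_le [Module.Finite (IwasawaAlgebra p) M]
    (hM : Module.IsTorsion (IwasawaAlgebra p) M)
    (hB : ∀ n : ℕ, muInvariant p ↥((augIdealP p ^ n) • (⊤ : Submodule (IwasawaAlgebra p) M)) = 0 →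
      muInvariant p M ≤ n) :
    muInvariant p (M ⧸ augIdealP p • (⊤ : Submodule (IwasawaAlgebra p) M)) ≤ 1 := by
  let 𝔭 : PrimeSpectrum (IwasawaAlgebra p) := ⟨augIdealP p, isPrime_augIdealP_holds p⟩
  let π : IwasawaAlgebra p := PowerSeries.C (p : ℤ_[p])
  -- finiteness of all the lengths involved
  have hMfin : lengthAt (IwasawaAlgebra p) M 𝔭 ≠ ⊤ := lengthAt_ne_top_of_isTorsion p _ hM 𝔭 rfl
  -- the sequences `b j = ℓ(p^jM)`, `a j = ℓ(p^jM/p^{j+1}M)` as natural numbers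
  let B : ℕ → ℕ∞ := fun j =>
    lengthAt (IwasawaAlgebra p) ↥((Ideal.span {π} ^ j) • (⊤ : Submodule (IwasawaAlgebra p) M)) 𝔭
  let A : ℕ → ℕ∞ := fun j =>
    lengthAt (IwasawaAlgebra p) (↥((Ideal.span {π} ^ j) • (⊤ : Submodule (IwasawaAlgebra p) M)) ⧸
      (Ideal.span {π} • (⊤ : Submodule (IwasawaAlgebra p)
        ↥((Ideal.span {π} ^ j) • (⊤ : Submodule (IwasawaAlgebra p) M))))) 𝔭
  have hBfin : ∀ j, B j ≠ ⊤ := fun j => ne_top_of_le_ne_top hMfin (lengthAt_submodule_le _ 𝔭)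
  have hAfin : ∀ j, A j ≠ ⊤ := fun j => ne_top_of_le_ne_top (hBfin j) (lengthAt_quotient_le _ 𝔭)
  have hBA : ∀ j, B j = B (j + 1) + A j := fun j => lengthAt_pow_smul_top_eq_succ_add_gradedPiece π 𝔭 j
  have hAA : ∀ j, A (j + 1) ≤ A j := fun j => lengthAt_gradedPiece_succ_le π 𝔭 j
  let b : ℕ → ℕ := fun j => (B j).toNat
  let a : ℕ → ℕ := fun j => (A j).toNat
  have hb : ∀ j, b j = b (j + 1) + a j := by
    intro j
    change (B j).toNat = (B (j + 1)).toNat + (A j).toNat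
    rw [hBA j, ENat.toNat_add (hBfin _) (hAfin _)]
  have ha : ∀ j, a (j + 1) ≤ a j := fun j => ENat.toNat_le_toNat (hAA j) (hAfin j)
  -- some `b v = 0`
  obtain ⟨v, hv⟩ := exists_lengthAt_pow_smul_top_eq_zero (M := M) hM
  have hbv : b v = 0 := by change (B v).toNat = 0; rw [show B v = 0 from hv]; rfl
  -- `a 0 = w`, `b 0 = μ(M)`, `b n = μ(p^nM)`
  have ha0 : a 0 = muInvariant p (M ⧸ augIdealP p • (⊤ : Submodule (IwasawaAlgebra p) M)) := by
    change (A 0).toNat = _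
    rw [muInvariant_eq_toNat_lengthAt p _ 𝔭 rfl]
    exact congrArg ENat.toNat (lengthAt_gradedPiece_zero π 𝔭)
  have hb0 : b 0 = muInvariant p M := by
    change (B 0).toNat = _
    rw [muInvariant_eq_toNat_lengthAt p _ 𝔭 rfl]
    exact congrArg ENat.toNat (lengthAt_pow_zero_smul_top π 𝔭)
  have hbn : ∀ n, b n = muInvariant p ↥((augIdealP p ^ n) • (⊤ : Submodule (IwasawaAlgebra p) M)) := by
    intro n
    change (B n).toNat = _
    rw [muInvariant_eq_toNat_lengthAt p _ 𝔭 rfl]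
    rfl
  -- suppose `w ≥ 2`
  by_contra hw
  push Not at hw
  have h2 : 2 ≤ a 0 := by rw [ha0]; omega
  obtain ⟨d, hd, hd1⟩ := exists_eq_zero_and_succ_le a b hb ha hbv h2
  have := hB d (by rw [← hbn d]; exact hd)
  rw [← hb0] at this
  omega

/-- **`μ(M) = 0 ⟺ μ(M/pM) = 0`** for `M` finitely generated torsion (Nakayama at `(p)` by length counting: if the first
graded piece has length `0` so do all, and `μ(M) = μ(p^vM) = 0`). [cite: Washington1997, §13.2] -/
theorem muInvariant_eq_zero_iff_residualWidth_eq_zero [Module.Finite (IwasawaAlgebra p) M]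
    (hM : Module.IsTorsion (IwasawaAlgebra p) M) :
    muInvariant p M = 0 ↔ muInvariant p (M ⧸ augIdealP p • (⊤ : Submodule (IwasawaAlgebra p) M)) = 0 := by
  let 𝔭 : PrimeSpectrum (IwasawaAlgebra p) := ⟨augIdealP p, isPrime_augIdealP_holds p⟩
  let π : IwasawaAlgebra p := PowerSeries.C (p : ℤ_[p])
  have hMfin : lengthAt (IwasawaAlgebra p) M 𝔭 ≠ ⊤ := lengthAt_ne_top_of_isTorsion p _ hM 𝔭 rfl
  constructor
  · intro h0
    have hle : muInvariant p (M ⧸ augIdealP p • (⊤ : Submodule (IwasawaAlgebra p) M)) ≤ muInvariant p M := by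
      rw [muInvariant_eq_toNat_lengthAt p _ 𝔭 rfl, muInvariant_eq_toNat_lengthAt p M 𝔭 rfl]
      exact ENat.toNat_le_toNat (lengthAt_quotient_le _ 𝔭) hMfin
    omega
  · intro hw
    -- all graded pieces vanish, so `ℓ(p^jM) = ℓ(M)` for all `j`; and some `ℓ(p^vM) = 0`
    let B : ℕ → ℕ∞ := fun j =>
      lengthAt (IwasawaAlgebra p) ↥((Ideal.span {π} ^ j) • (⊤ : Submodule (IwasawaAlgebra p) M)) 𝔭
    let A : ℕ → ℕ∞ := fun j =>
      lengthAt (IwasawaAlgebra p) (↥((Ideal.span {π} ^ j) • (⊤ : Submodule (IwasawaAlgebra p) M)) ⧸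
        (Ideal.span {π} • (⊤ : Submodule (IwasawaAlgebra p)
          ↥((Ideal.span {π} ^ j) • (⊤ : Submodule (IwasawaAlgebra p) M))))) 𝔭
    have hA0 : A 0 = 0 := by
      have hfinQ : lengthAt (IwasawaAlgebra p) (M ⧸ augIdealP p • (⊤ : Submodule (IwasawaAlgebra p) M)) 𝔭 ≠ ⊤ :=
        ne_top_of_le_ne_top hMfin (lengthAt_quotient_le _ 𝔭)
      rw [muInvariant_eq_toNat_lengthAt p _ 𝔭 rfl, ENat.toNat_eq_zero] at hw
      have h := hw.resolve_right hfinQ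
      change lengthAt _ _ 𝔭 = 0
      rw [lengthAt_gradedPiece_zero π 𝔭]
      exact h
    have hAj : ∀ j, A j = 0 := by
      intro j
      induction j with
      | zero => exact hA0
      | succ j ih => exact nonpos_iff_eq_zero.mp ((lengthAt_gradedPiece_succ_le π 𝔭 j).trans ih.le)
    have hBj : ∀ j, B j = B 0 := by
      intro j
      induction j with
      | zero => rfl
      | succ j ih =>
        have h := lengthAt_pow_smul_top_eq_succ_add_gradedPiece (M := M) π 𝔭 j
        change B j = B (j + 1) + A j at h
        rw [hAj j, add_zero] at h
        rw [← h, ih]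
    obtain ⟨v, hv⟩ := exists_lengthAt_pow_smul_top_eq_zero (M := M) hM
    have hB0 : B 0 = 0 := by rw [← hBj v]; exact hv
    rw [muInvariant_eq_toNat_lengthAt p M 𝔭 rfl, ← lengthAt_pow_zero_smul_top π 𝔭]
    change (B 0).toNat = 0
    rw [hB0]; rfl

/-- **B2's module statement is EQUIVALENT to `μ(M/pM) ≤ 1`** for `M` finitely generated torsion.
[cite: Washington1997, §13.2] -/
theorem forall_mu_le_iff_residualWidth_le_one [Module.Finite (IwasawaAlgebra p) M]
    (hM : Module.IsTorsion (IwasawaAlgebra p) M) :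
    (∀ n : ℕ, muInvariant p ↥((augIdealP p ^ n) • (⊤ : Submodule (IwasawaAlgebra p) M)) = 0 →
      muInvariant p M ≤ n) ↔
    muInvariant p (M ⧸ augIdealP p • (⊤ : Submodule (IwasawaAlgebra p) M)) ≤ 1 :=
  ⟨residualWidth_le_one_of_forall_mu_le hM, fun hw n h0 => mu_le_of_residualWidth_le_one hw n h0⟩

end Lambda

/-! ## §3 At a pair and on the class: B2 ⟺ `w(X₀) ≤ 1`, Conjecture A ⟺ `w(X₀) = 0` -/

section Pairs

/-- **«`w(X₀) ≤ 1` at every X9 pair» ⟹ B2 (`SIM.FineMuConcentratedOnClassX9`) — UNCONDITIONALLY** (no F1_ζ, no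
modularity: the width certificate holds for every `Λ`-module). [cite: CoatesSujatha2005, §3 Conjecture A (the case `w = 0`)]
[cite: Washington1997, §13.2] -/
theorem fineMuConcentratedOnClassX9_of_residualWidth_le_one
    (hw : ∀ (W : WeierstrassCurve ℚ) [W.IsElliptic] [W.IsGloballyMinimal] (p : ℕ) [Fact p.Prime],
      ClassX9 W p → ∀ (κ : ZpExtension ℚ p) (γ : absoluteGaloisGroup ℚ), κ.IsCyclotomic →
      κ.IsTopGenerator γ → IsCyclotomicVariable p γ → ∀ Y : W.FineSelmerDualData κ γ,
        muInvariant p (Y.X ⧸ augIdealP p • (⊤ : Submodule (IwasawaAlgebra p) Y.X)) ≤ 1) :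
    FineMuConcentratedOnClassX9 := by
  intro W _ _ p _ κ γ hX9 hκ hγ hγ' Y n hn0
  exact mu_le_of_residualWidth_le_one (hw W p hX9 κ γ hκ hγ hγ' Y) n hn0

/-- **B2 ⟹ «`w(X₀) ≤ 1` at every X9 pair»**, modulo F1_ζ and a modularity witness (used ONLY to know that every dual
fine Selmer datum at an odd good ordinary pair is finitely generated torsion, `finite_and_isTorsion_fine_of_zeta`).
So B2 on X9 is EXACTLY the residual-width statement. [cite: Kato2004Asterisque, Thm. 12.4 (1) (p. 221), (14.9.3) (p. 240), §17.13]
[cite: Washington1997, §13.2] -/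
theorem residualWidth_le_one_of_fineMuConcentratedOnClassX9 (hfine : exists_divisibilityInputs_fineQuotient_zeta)
    (hmodP : nonempty_modularParametrizationData) (hB : FineMuConcentratedOnClassX9)
    (W : WeierstrassCurve ℚ) [W.IsElliptic] [W.IsGloballyMinimal] (p : ℕ) [Fact p.Prime] (hX9 : ClassX9 W p)
    (κ : ZpExtension ℚ p) (γ : absoluteGaloisGroup ℚ) (hκ : κ.IsCyclotomic) (hγ : κ.IsTopGenerator γ)
    (hγ' : IsCyclotomicVariable p γ) (Y : W.FineSelmerDualData κ γ) :
    muInvariant p (Y.X ⧸ augIdealP p • (⊤ : Submodule (IwasawaAlgebra p) Y.X)) ≤ 1 := by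
  obtain ⟨-, h5, hgood, hap, -, -⟩ := id hX9
  have hp2 : p ≠ 2 := by omega
  obtain ⟨hYf, hYt⟩ := finite_and_isTorsion_fine_of_zeta hfine hmodP hp2 ⟨hgood, hap⟩ hκ hγ hγ' Y
  haveI := hYf
  exact residualWidth_le_one_of_forall_mu_le hYt fun n hn0 => hB W p κ γ hX9 hκ hγ hγ' Y n hn0

/-- **At an odd good ordinary pair: `μ(X₀) = 0 ⟺ w(X₀) = 0`** for every dual fine Selmer datum over cyclotomic data
(guards from F1_ζ + a modularity witness).  So on X9, Conjecture A (`μ(X₀) = 0`, `Rank1Residual.FineMuZeroAt`) and B2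
(`w(X₀) ≤ 1`) are thresholds `0` and `1` of the SAME invariant `w(X₀) = μ(X₀/pX₀)`.
[cite: CoatesSujatha2005, §3 Conjecture A] [cite: Washington1997, §13.2] -/
theorem fineMuZero_iff_residualWidth_eq_zero (hfine : exists_divisibilityInputs_fineQuotient_zeta)
    (hmodP : nonempty_modularParametrizationData)
    {W : WeierstrassCurve ℚ} [W.IsElliptic] [W.IsGloballyMinimal] {p : ℕ} [Fact p.Prime] (hp2 : p ≠ 2)
    (hord : IsOrdinaryAt W p) {κ : ZpExtension ℚ p} {γ : absoluteGaloisGroup ℚ} (hκ : κ.IsCyclotomic)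
    (hγ : κ.IsTopGenerator γ) (hγ' : IsCyclotomicVariable p γ) (Y : W.FineSelmerDualData κ γ) :
    muInvariant p Y.X = 0 ↔ muInvariant p (Y.X ⧸ augIdealP p • (⊤ : Submodule (IwasawaAlgebra p) Y.X)) = 0 := by
  obtain ⟨hYf, hYt⟩ := finite_and_isTorsion_fine_of_zeta hfine hmodP hp2 hord hκ hγ hγ' Y
  haveI := hYf
  exact muInvariant_eq_zero_iff_residualWidth_eq_zero hYt

end Pairs

/-! ## §4 Line currency: DEPTH ⟹ `μ(X₀) ≤ n · w(X₀)`; DEPTH ∧ «`w ≤ 1` on X9» ⟹ S-es-3 (⟹ the crux, p610638) -/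

section Line

/-- **DEPTH (ES-C4) bounds the fine `μ` by loss × residual width**: at an X9 pair, if some genuine Euler-system class
has Euler loss `≤ n` (`s ∉ p^{n+1}𝐇¹`), then `μ(X₀) ≤ n · w(X₀)` for every dual fine Selmer datum — unconditionally in
`n` and `w` (MEMO-es §14 (N2) `μ(X₀) ≤ s_μ(X₀)·δ`, in the kernel, with `s_μ = w = μ(X₀/pX₀)`).
[cite: Kato2004Asterisque, Thm. 13.4 (p. 226) and §13.8] [cite: Washington1997, §13.2] -/
theorem fineMu_le_mul_residualWidth_of_depth (h4 : FineExponentLeEulerLossOnClassX9)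
    (W : WeierstrassCurve ℚ) [W.IsElliptic] [W.IsGloballyMinimal] (p : ℕ) [Fact p.Prime]
    [ContinuousSMul ℤ_[p] (W.tateModule p)] [Module.Free ℤ_[p] (W.tateModule p)]
    [Module.Finite ℤ_[p] (W.tateModule p)]
    (κ : ZpExtension ℚ p) (γ : absoluteGaloisGroup ℚ) (I : IwasawaH1Data W p κ γ) (n : ℕ)
    (hX9 : ClassX9 W p) (hκ : κ.IsCyclotomic) (hγ : κ.IsTopGenerator γ) (hγ' : IsCyclotomicVariable p γ)
    (hs : ∃ s : I.H, IsEulerSystemClass W p κ γ I s ∧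
      s ∉ (augIdealP p ^ (n + 1)) • (⊤ : Submodule (IwasawaAlgebra p) I.H))
    (Y : W.FineSelmerDualData κ γ) :
    muInvariant p Y.X ≤ n * muInvariant p (Y.X ⧸ augIdealP p • (⊤ : Submodule (IwasawaAlgebra p) Y.X)) := by
  have h0 := h4 W p κ γ I n hX9 hκ hγ hγ' hs Y
  have h := muInvariant_le_pow_smul_top_add_mul_residualWidth (p := p) (M := Y.X) n
  rw [h0, zero_add] at h
  exact h

/-- **DEPTH ∧ «`w(X₀) ≤ 1` on X9» ⟹ S-es-3 (`SIM.FineMuLeEulerLossOnClassX9`)** — the two stubs of the line of record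
with WIDTH spelled in residual currency (pure logic through the tree edge
`SIM.fineMuLeEulerLossOnClassX9_of_exponent_of_concentrated`); the ROUTE decl `KatoDivisibilityX9` then follows from
F1_ζ by the landed Theses-side edge `katoDivisibilityX9_of_fineMuLeEulerLossOnClassX9` (p610638), not imported here.
[cite: Kato2004Asterisque, Thm. 13.4 (p. 226) and §13.8] [cite: Washington1997, §13.2] -/
theorem fineMuLeEulerLossOnClassX9_of_depth_of_residualWidth_le_one (h4 : FineExponentLeEulerLossOnClassX9)
    (hw : ∀ (W : WeierstrassCurve ℚ) [W.IsElliptic] [W.IsGloballyMinimal] (p : ℕ) [Fact p.Prime],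
      ClassX9 W p → ∀ (κ : ZpExtension ℚ p) (γ : absoluteGaloisGroup ℚ), κ.IsCyclotomic →
      κ.IsTopGenerator γ → IsCyclotomicVariable p γ → ∀ Y : W.FineSelmerDualData κ γ,
        muInvariant p (Y.X ⧸ augIdealP p • (⊤ : Submodule (IwasawaAlgebra p) Y.X)) ≤ 1) :
    FineMuLeEulerLossOnClassX9 :=
  fineMuLeEulerLossOnClassX9_of_exponent_of_concentrated h4 (fineMuConcentratedOnClassX9_of_residualWidth_le_one hw)

end Line

end Summit.BirchSwinnertonDyer.BirchSwinnertonDyer.Theorems.OneSidedTwistSqueezeX9KatoDivisibilityX9ResidualWidthX9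

end
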